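import Literature.AlgebraicGeometry.AbelianSchemes.SerreTwistExactPolarizationExists   -- ★ `exists_serreTranslate_comp_eq_i_of_mem` (+ ★ KER-EQ recognition, ★ descent)
import HarnessLib

/-!
# The two-sided Serre presentation «`c ≫ d_a = ι(a)`, `d_a ≫ c = ι′(a)` (`a ∈ 𝔞`)» of an EQUIVARIANT SURJECTIVE HOMOMORPHISM WITH KERNEL `A[𝔞]`
# ([MumfordAV1970] §7 Thm. 4; [Conrad2004GrossZagier] §7 Thm. 7.5; [MilneCM2006] §7)

Topic `AlgebraicGeometry/AbelianSchemes`, namespace `Literature.AlgebraicGeometry.AbelianSchemes.AbelianSchemeOver`.  THEOREMS ONLY (no definition, no instance, no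
notation, no named fact, no `sorry`).  Cell `hodgecm-mathlib` (D-0151), P6 «MOD», line L3 (socket `stub_FROB`, `--supports stmt-HodgeConjecture-24832`, count-neutral):
organ «(f1) FROM (f1′)» of the Db-FREE cover road (δ) (A-p03 (g31) «Q-DUALS-D», desk F0P6a-plan (g4) «=»): Defs `FrobCover₀` asks for BOTH the scheme-theoretic kernel
clause (f1′) «`t ≫ c̄ = 1 ↔ ∀ a ∈ 𝔞, t ≫ ι(a) = 1` on all `T`-points, `c̄` surjective» AND the two-sided presentation (f1) «`∀ a ∈ 𝔞, ∃ d, c̄ ≫ d = ι(a) ∧ d ≫ c̄ = ι′(a)`»;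
★ (ν8)(i)(ii) + the kernel conjunct of (ν8k) deliver (f1′), (f4) and surjectivity downstairs; THIS file turns them into (f1) over the algebraically closed residue
field, with NO dual pair and NO polarisation in sight.  HC_CM is proved only modulo the printed citations until rung 0 closes; generic capital.

THE MATHEMATICS.  `Ω` algebraically closed, `A, B` abelian schemes over `Spec Ω` with `𝒪`-actions `ι, ι′`, `φ : A → B` an equivariant homomorphism with `φ.left`
surjective and `Ker φ = A[𝔞]` as subgroup functors, `(E′, P, Q, N)` a Serre presentation of `𝔞` (`N ≠ 0`).  Then `φ` IS the Serre cover: ★ KER-EQ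
`exists_iso_serreTranslate_comp_eq_equivariant_of_comp_eq_one_iff_forall_mem` gives an equivariant isomorphism `e : A ⊗_𝒪 𝔟 ≅ B` with `ψ_P ≫ e = φ`
([MumfordAV1970] §7 Thm. 4).  For `a ∈ 𝔞`, `ι(a)` kills `Ker ψ_P = A[𝔞]`, so `ι(a) = ψ_P ≫ g_a` (★ `exists_serreTranslate_comp_eq_i_of_mem`), and `g_a ≫ ψ_P = ι_{A⊗𝔟}(a)` by the
UNIQUENESS of descent through the fppf epimorphism `ψ_P` (both sides precompose with `ψ_P` to `ι(a) ≫ ψ_P`, ★ `i_comp_serreTranslate`, ★ `existsUnique_comp_eq_of_forall_comp_eq_one`).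
Put `d_a := e⁻¹ ≫ g_a`: `φ ≫ d_a = ψ_P ≫ g_a = ι(a)` and `d_a ≫ φ = e⁻¹ ≫ ι_{A⊗𝔟}(a) ≫ e = ι′(a)` (equivariance of `e`).

* §1 `serreTranslate_twoSided_presentation` — the model case `φ = ψ_P` (`ι(a) = ψ_P ≫ g_a`, `g_a ≫ ψ_P = ι_{A⊗𝔟}(a)`), over ANY base.
* §2 HEAD `exists_twoSided_presentation_of_comp_eq_one_iff_forall_mem` — the statement above (over `Ω = Ω̄`), in the token shape of Defs `FrobCover₀` (f1) with
  `act₀Of … a x̄′ ↦ act.i a`, `baseChangeHom (act₀Of … a x̄) (frobSpec …) ↦ actB.i a`.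

## References
* [MumfordAV1970] D. Mumford, *Abelian Varieties* (1970), §7 Thm. 4 (p. 72) (quotients by finite subgroups; descent of homomorphisms).
* [Conrad2004GrossZagier] B. Conrad, *Gross–Zagier revisited*, MSRI Publ. 49 (2004), §7 Thm. 7.5 (the Serre tensor construction `A ⊗_𝒪 𝔟`).
* [MilneCM2006] J. S. Milne, *Complex Multiplication* (2006), §7 (Def. 7.19, Prop. 7.22, Rem. 7.23, pp. 58–59) (`𝔞`-multiplications).
-/

set_option autoImplicit false

-- as the ★ Serre-tensor files: `Over`/`Scheme` wrappers are semireducible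
set_option backward.isDefEq.respectTransparency false

noncomputable section

universe u

open CategoryTheory CategoryTheory.Limits AlgebraicGeometry MonoidalCategory CartesianMonoidalCategory
open scoped MonObj

namespace Literature.AlgebraicGeometry.AbelianSchemes

namespace AbelianSchemeOver

/-! ## §1 The model case: the two-sided presentation of the Serre cover `ψ_P` itself (any base) -/

section Model

variable {S : Scheme.{u}} {A : AbelianSchemeOver S} {O : Type*} [CommRing O] (act : A.RingAction O) [IsCommMonObj A.X]
  {m : ℕ} (E' : Matrix (Fin m) (Fin m) O) (hE' : E' * E' = E') (P : Matrix (Fin m) (Fin 1) O) (Q : Matrix (Fin 1) (Fin m) O) {N : ℕ}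

/-- **THE TWO-SIDED PRESENTATION OF THE SERRE COVER**: for `a ∈ 𝔭` (the ideal generated by the coordinates of `P`) there is a homomorphism
`g : A ⊗_𝒪 𝔟 → A` with `ψ_P ≫ g = ι(a)` AND `g ≫ ψ_P = ι_{A⊗𝔟}(a)` — the first by descent of `ι(a)` through `ψ_P` (★ `exists_serreTranslate_comp_eq_i_of_mem`), the
second by the UNIQUENESS of that descent applied to `ι(a) ≫ ψ_P = ψ_P ≫ ι_{A⊗𝔟}(a)` (★ `i_comp_serreTranslate`, ★ `existsUnique_comp_eq_of_forall_comp_eq_one`).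
[cite: MumfordAV1970, §7 Thm. 4 (p. 72)] [cite: Conrad2004GrossZagier, §7 (Thm. 7.5)] -/
theorem serreTranslate_twoSided_presentation (hN : N ≠ 0) (hP : E' * P = P) (hQ : Q * E' = Q)
    (hQP : Q * P = Matrix.scalar (Fin 1) (N : O)) (hPQ : P * Q = Matrix.scalar (Fin m) (N : O) * E')
    {𝔭 : Ideal O} (h𝔭 : Ideal.span (Set.range fun k => P k 0) = 𝔭) {a : O} (ha : a ∈ 𝔭) :
    ∃ g : (serreTensor act E' hE').X ⟶ A.X, IsMonHom g ∧ serreTranslate act E' hE' P ≫ g = act.i a ∧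
      g ≫ serreTranslate act E' hE' P = (serreAction act E' hE').i a := by
  haveI := isMonHom_serreTranslate act E' hE' P
  haveI := act.isMonHom a
  haveI := (serreAction act E' hE').isMonHom a
  haveI := flat_serreTranslate_left act E' hE' P Q hN hP hQ hQP hPQ
  haveI := surjective_serreTranslate_left act E' hE' P Q hN hP hQ hQP hPQ
  haveI := quasiCompact_serreTranslate_left act E' hE' P Q hN hP hQ hQP hPQ
  obtain ⟨g, hg, hfac⟩ := exists_serreTranslate_comp_eq_i_of_mem act E' hE' P Q hN hP hQ hQP hPQ h𝔭 ha
  haveI := hg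
  refine ⟨g, hg, hfac, ?_⟩
  -- both `g ≫ ψ` and `ι_{A⊗𝔟}(a)` are descents of `ι(a) ≫ ψ` through `ψ`
  have hkill : ∀ ⦃T : Over S⦄ (t : T ⟶ A.X), t ≫ serreTranslate act E' hE' P = 1 →
      t ≫ (act.i a ≫ serreTranslate act E' hE' P) = 1 := fun T t ht => by
    rw [i_comp_serreTranslate act E' hE' P hP a, ← Category.assoc, ht, MonObj.one_comp]
  obtain ⟨χ, -, huniq⟩ := A.existsUnique_comp_eq_of_forall_comp_eq_one (serreTranslate act E' hE' P)
    (act.i a ≫ serreTranslate act E' hE' P) hkill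
  have h1 : g ≫ serreTranslate act E' hE' P = χ :=
    huniq _ (show serreTranslate act E' hE' P ≫ (g ≫ serreTranslate act E' hE' P) = act.i a ≫ serreTranslate act E' hE' P by
      rw [← Category.assoc, hfac])
  have h2 : (serreAction act E' hE').i a = χ :=
    huniq _ (show serreTranslate act E' hE' P ≫ (serreAction act E' hE').i a = act.i a ≫ serreTranslate act E' hE' P by
      rw [i_comp_serreTranslate act E' hE' P hP a])
  rw [h1, h2]

end Model

/-! ## §2 HEAD: the two-sided presentation of an equivariant surjective homomorphism with kernel `A[𝔞]` (over an algebraically closed field) -/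

section Head

variable {Ω : Type u} [Field Ω] [IsAlgClosed Ω] {A B : AbelianSchemeOver (Spec (.of Ω))} {O : Type*} [CommRing O]
  (act : A.RingAction O) (actB : B.RingAction O) [IsCommMonObj A.X]
  {m : ℕ} (E' : Matrix (Fin m) (Fin m) O) (hE' : E' * E' = E') (P : Matrix (Fin m) (Fin 1) O) (Q : Matrix (Fin 1) (Fin m) O) {N : ℕ}
  (φ : A.X ⟶ B.X) [IsMonHom φ] [Surjective φ.left]

include hE' in
/-- **(f1) FROM (f1′): THE TWO-SIDED SERRE PRESENTATION OF AN EQUIVARIANT SURJECTIVE HOMOMORPHISM WITH KERNEL `A[𝔞]`.**  `Ω = Ω̄`; `φ : A → B` an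
`𝒪`-equivariant homomorphism (`hφ`), `φ.left` surjective, `Ker φ = A[𝔞]` on ALL `T`-points (`hker`, the (f1′)∕(r2₀) shape of Defs `FrobCover₀`∕`Roof₀`); `(E′, P, Q, N)` a Serre
presentation of `𝔞` with `N ≠ 0` (★ `exists_serrePresentation_of_ideal`).  THEN for every `a ∈ 𝔞` there is `d : B → A` with `φ ≫ d = ι(a)` and `d ≫ φ = ι′(a)` — the (f1)
clause.  (`φ = ψ_P ≫ e` for an EQUIVARIANT isomorphism `e` by ★ KER-EQ `exists_iso_serreTranslate_comp_eq_equivariant_of_comp_eq_one_iff_forall_mem`; `d := e⁻¹ ≫ g_a` with §1.)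
[cite: MumfordAV1970, §7 Thm. 4 (p. 72)] [cite: Conrad2004GrossZagier, §7 (Thm. 7.5)] [cite: MilneCM2006, §7 (Def. 7.19, Prop. 7.22, Rem. 7.23, pp. 58–59)] -/
theorem exists_twoSided_presentation_of_comp_eq_one_iff_forall_mem
    (hN : N ≠ 0) (hP : E' * P = P) (hQ : Q * E' = Q)
    (hQP : Q * P = Matrix.scalar (Fin 1) (N : O)) (hPQ : P * Q = Matrix.scalar (Fin m) (N : O) * E')
    {𝔞 : Ideal O} (h𝔞 : Ideal.span (Set.range fun k => P k 0) = 𝔞)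
    (hφ : ∀ a, act.i a ≫ φ = φ ≫ actB.i a)
    (hker : ∀ ⦃T : Over (Spec (.of Ω))⦄ (t : T ⟶ A.X), t ≫ φ = 1 ↔ ∀ a ∈ 𝔞, t ≫ act.i a = 1) :
    ∀ a ∈ 𝔞, ∃ d : B.X ⟶ A.X, φ ≫ d = act.i a ∧ d ≫ φ = actB.i a := by
  obtain ⟨e, he, -, hequiv, -⟩ :=
    exists_iso_serreTranslate_comp_eq_equivariant_of_comp_eq_one_iff_forall_mem act E' hE' P Q φ actB hN hP hQ hQP hPQ h𝔞 hφ hker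
  intro a ha
  obtain ⟨g, -, hψg, hgψ⟩ := serreTranslate_twoSided_presentation act E' hE' P Q hN hP hQ hQP hPQ h𝔞 ha
  refine ⟨e.inv ≫ g, ?_, ?_⟩
  · rw [← he, Category.assoc, e.hom_inv_id_assoc, hψg]
  · rw [Category.assoc, ← he, reassoc_of% hgψ, hequiv a, e.inv_hom_id_assoc]

end Head

/-! ## §3 (ED. 2, appended; §1–§2 token-identical) The model return map `g_a` is `𝒪`-EQUIVARIANT -/

section ModelEquivariant

variable {S : Scheme.{u}} {A : AbelianSchemeOver S} {O : Type*} [CommRing O] (act : A.RingAction O) [IsCommMonObj A.X]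
  {m : ℕ} (E' : Matrix (Fin m) (Fin m) O) (hE' : E' * E' = E') (P : Matrix (Fin m) (Fin 1) O) (Q : Matrix (Fin 1) (Fin m) O) {N : ℕ}

/-- **THE TWO-SIDED PRESENTATION OF THE SERRE COVER, WITH EQUIVARIANCE** (ED. 2; line L2 organ (ρ3-K) «K-data from the leg», LA2-p03 (g3)): for `a ∈ 𝔭` the return map
`g : A ⊗_𝒪 𝔟 → A` of §1 (`ψ_P ≫ g = ι(a)`, `g ≫ ψ_P = ι_{A⊗𝔟}(a)`) is `𝒪`-EQUIVARIANT: `ι_{A⊗𝔟}(x) ≫ g = g ≫ ι(x)` — both sides are descents through the fppf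
epimorphism `ψ_P` of `ι(a) ≫ ι(x) = ι(x·a)` (★ `i_comp_serreTranslate`, `𝒪` commutative, ★ `existsUnique_comp_eq_of_forall_comp_eq_one`).
[cite: MumfordAV1970, §7 Thm. 4 (p. 72)] [cite: Conrad2004GrossZagier, §7 (Thm. 7.5)] -/
theorem serreTranslate_twoSided_presentation_equivariant (hN : N ≠ 0) (hP : E' * P = P) (hQ : Q * E' = Q)
    (hQP : Q * P = Matrix.scalar (Fin 1) (N : O)) (hPQ : P * Q = Matrix.scalar (Fin m) (N : O) * E')
    {𝔭 : Ideal O} (h𝔭 : Ideal.span (Set.range fun k => P k 0) = 𝔭) {a : O} (ha : a ∈ 𝔭) :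
    ∃ g : (serreTensor act E' hE').X ⟶ A.X, IsMonHom g ∧ serreTranslate act E' hE' P ≫ g = act.i a ∧
      g ≫ serreTranslate act E' hE' P = (serreAction act E' hE').i a ∧
      ∀ x : O, (serreAction act E' hE').i x ≫ g = g ≫ act.i x := by
  haveI := isMonHom_serreTranslate act E' hE' P
  haveI := act.isMonHom
  haveI := (serreAction act E' hE').isMonHom
  haveI := flat_serreTranslate_left act E' hE' P Q hN hP hQ hQP hPQ
  haveI := surjective_serreTranslate_left act E' hE' P Q hN hP hQ hQP hPQ
  haveI := quasiCompact_serreTranslate_left act E' hE' P Q hN hP hQ hQP hPQ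
  obtain ⟨g, hg, hψg, hgψ⟩ := serreTranslate_twoSided_presentation act E' hE' P Q hN hP hQ hQP hPQ h𝔭 ha
  haveI := hg
  refine ⟨g, hg, hψg, hgψ, fun x => ?_⟩
  -- both `ι_{A⊗𝔟}(x) ≫ g` and `g ≫ ι(x)` are descents of `ι(x * a) = ι(a) ≫ ι(x)` through `ψ_P`
  have hkill : ∀ ⦃T : Over S⦄ (t : T ⟶ A.X), t ≫ serreTranslate act E' hE' P = 1 → t ≫ act.i (x * a) = 1 := fun T t ht => by
    rw [act.i_mul, ← hψg, ← Category.assoc, ← Category.assoc, ht, MonObj.one_comp, MonObj.one_comp]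
  obtain ⟨χ, -, huniq⟩ := A.existsUnique_comp_eq_of_forall_comp_eq_one (serreTranslate act E' hE' P) (act.i (x * a)) hkill
  have h1 : (serreAction act E' hE').i x ≫ g = χ :=
    huniq _ (show serreTranslate act E' hE' P ≫ ((serreAction act E' hE').i x ≫ g) = act.i (x * a) by
      rw [← Category.assoc, ← i_comp_serreTranslate act E' hE' P hP x, Category.assoc, hψg, ← act.i_mul, mul_comm])
  have h2 : g ≫ act.i x = χ :=
    huniq _ (show serreTranslate act E' hE' P ≫ (g ≫ act.i x) = act.i (x * a) by
      rw [← Category.assoc, hψg, ← act.i_mul])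
  rw [h1, h2]

end ModelEquivariant

end AbelianSchemeOver

end Literature.AlgebraicGeometry.AbelianSchemes

end
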